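import Mathlib
import Summits.NavierStokesRegularity.NavierStokesRegularity.Theorems.FilamentSkeletonRssSelectionBoxRJRungStraightSkewTools

/-!
# Route `FilamentSkeletonRss` · crux `SelectionBoxRJ` (stmt-NavierStokesRegularity-21220) — rung tools (R1):
# margins of the scale-free rung-0 profile `F(s) = a/(b + s²) + s/2 − k`

Lane `ns-filament-19175-p1` (g7); helper file `--supports stmt-NavierStokesRegularity-21220`, route-independent.  The
perturbative zero analysis of the model rung (`…RungModelArcSlip.lean`) compares the slip of a near-straight arc with the
rung-0 profile `√Γ·F(t/√Γ)` of `…RungStraightSkewTools` (`a = 4/(5π)`, `k = (21/25)/√2`, `b = 4/25 + 1/Γ ∈ [4/25, 4/25 + 10⁻⁴]`)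
and needs MARGINS rather than signs: `F(−9/20) < −1/10`, `F(−7/20) > 1/10`, `F ≥ 1/12` on `[0, ∞)` (polynomial certificate),
`F(s) > s/2 − 3/5`, and the slope window `2 ≤ F′ ≤ 31/10` on `[−9/20, −7/20]` (decoupled bounds on two halves).

HONEST FRAMING.  Elementary real inequalities for the MODEL rung of a HYPOTHETICAL filament box; nothing here is a claim
about Navier–Stokes regularity or blow-up.
-/

set_option linter.dupNamespace false -- `Theorems.…Theorems`-style path/namespace repetition is the tree convention

noncomputable section

namespace Summit.NavierStokesRegularity.NavierStokesRegularity.Theorems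

open Set Real

namespace SelectionBoxRJRung

/-! ### Margins of the scale-free profile (`b ∈ [4/25, 4/25 + 10⁻⁴]`) -/

/-- The profile is `< −1/10` at `s = −9/20`. [folklore] -/
theorem F_neg_wide {b : ℝ} (hb : 4 / 25 ≤ b) :
    4 / (5 * Real.pi) / (b + (-9 / 20 : ℝ) ^ 2) + (-9 / 20 : ℝ) / 2 - 21 / 25 * (Real.sqrt 2)⁻¹ < -1 / 10 := by
  obtain ⟨ha1, ha2⟩ := aC_bounds
  obtain ⟨hk1, hk2⟩ := kC_bounds
  have hden : 0 < b + (-9 / 20 : ℝ) ^ 2 := by nlinarith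
  have : 4 / (5 * Real.pi) / (b + (-9 / 20 : ℝ) ^ 2) < 9 / 40 + 21 / 25 * (Real.sqrt 2)⁻¹ - 1 / 10 := by
    rw [div_lt_iff₀ hden]; nlinarith
  linarith

/-- The profile is `> 1/10` at `s = −7/20`. [folklore] -/
theorem F_pos_wide {b : ℝ} (hb : 4 / 25 ≤ b) (hb' : b ≤ 4 / 25 + 1 / 10000) :
    1 / 10 < 4 / (5 * Real.pi) / (b + (-7 / 20 : ℝ) ^ 2) + (-7 / 20 : ℝ) / 2 - 21 / 25 * (Real.sqrt 2)⁻¹ := by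
  obtain ⟨ha1, ha2⟩ := aC_bounds
  obtain ⟨hk1, hk2⟩ := kC_bounds
  have hden : 0 < b + (-7 / 20 : ℝ) ^ 2 := by nlinarith
  have : 7 / 40 + 21 / 25 * (Real.sqrt 2)⁻¹ + 1 / 10 < 4 / (5 * Real.pi) / (b + (-7 / 20 : ℝ) ^ 2) := by
    rw [lt_div_iff₀ hden]; nlinarith
  linarith

/-- **Quantitative positivity on `[0, ∞)`:** `F(s) ≥ 1/12` for `s ≥ 0` (polynomial certificate for
`a + (s/2 − k − 1/12)(b + s²) > 0`: it equals `½(s − 21/25)²(s + u) + (positive)`). [folklore] -/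
theorem F_ge_of_nonneg {b : ℝ} (hb : 4 / 25 ≤ b) (hb' : b ≤ 4 / 25 + 1 / 10000) {s : ℝ} (hs : 0 ≤ s) :
    1 / 12 ≤ 4 / (5 * Real.pi) / (b + s ^ 2) + s / 2 - 21 / 25 * (Real.sqrt 2)⁻¹ := by
  obtain ⟨ha1, ha2⟩ := aC_bounds
  obtain ⟨hk1, hk2⟩ := kC_bounds
  set a : ℝ := 4 / (5 * Real.pi) with ha
  set k : ℝ := 21 / 25 * (Real.sqrt 2)⁻¹ with hk
  have hden : 0 < b + s ^ 2 := by nlinarith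
  have key : 0 ≤ a + (s / 2 - k - 1 / 12) * (b + s ^ 2) := by
    nlinarith [mul_nonneg (sq_nonneg (s - 21 / 25)) (by linarith : (0:ℝ) ≤ s + 33 / 100), mul_nonneg hs (sq_nonneg s),
      sq_nonneg (s - 21 / 25), mul_nonneg hs (by linarith : (0:ℝ) ≤ 4 / 25 + 1 / 10000 - b),
      mul_nonneg (mul_nonneg hs hs) (by linarith : (0:ℝ) ≤ 4 / 25 + 1 / 10000 - b)]
  have : a / (b + s ^ 2) + s / 2 - k - 1 / 12 = (a + (s / 2 - k - 1 / 12) * (b + s ^ 2)) / (b + s ^ 2) := by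
    field_simp
    ring
  have h2 : 0 ≤ a / (b + s ^ 2) + s / 2 - k - 1 / 12 := by rw [this]; positivity
  linarith

/-- **Linear lower bound:** `F(s) > s/2 − 3/5` for all `s` (`a/(b + s²) > 0`, `k < 3/5`). [folklore] -/
theorem F_gt_linear {b : ℝ} (hb : 4 / 25 ≤ b) (s : ℝ) :
    s / 2 - 3 / 5 < 4 / (5 * Real.pi) / (b + s ^ 2) + s / 2 - 21 / 25 * (Real.sqrt 2)⁻¹ := by
  obtain ⟨hk1, hk2⟩ := kC_bounds
  have hden : 0 < b + s ^ 2 := by nlinarith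
  have : 0 < 4 / (5 * Real.pi) / (b + s ^ 2) := by positivity
  linarith

/-- **Slope window on `[−9/20, −7/20]`:** `2 ≤ ½ − 2 a s/(b + s²)² ≤ 31/10` (decoupled bounds on the two halves
`[−9/20, −2/5]` and `[−2/5, −7/20]`). [folklore] -/
theorem Fderiv_window_wide {b s : ℝ} (hb : 4 / 25 ≤ b) (hb' : b ≤ 4 / 25 + 1 / 10000) (hs1 : -9 / 20 ≤ s)
    (hs2 : s ≤ -7 / 20) :
    2 ≤ 1 / 2 - 2 * (4 / (5 * Real.pi)) * s / (b + s ^ 2) ^ 2 ∧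
      1 / 2 - 2 * (4 / (5 * Real.pi)) * s / (b + s ^ 2) ^ 2 ≤ 31 / 10 := by
  obtain ⟨ha1, ha2⟩ := aC_bounds
  set a : ℝ := 4 / (5 * Real.pi) with ha
  have hrw : 2 * a * s / (b + s ^ 2) ^ 2 = -(-(2 * a * s) / (b + s ^ 2) ^ 2) := by ring
  rcases le_or_gt s (-2 / 5) with hmid | hmid
  · -- `s ∈ [−9/20, −2/5]`
    have hs2' : 0.16 ≤ s ^ 2 := by nlinarith
    have hs2'' : s ^ 2 ≤ 0.2025 := by nlinarith
    have hD1 : 0.1024 ≤ (b + s ^ 2) ^ 2 := by nlinarith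
    have hD2 : (b + s ^ 2) ^ 2 ≤ 0.1315 := by nlinarith
    have hDpos : 0 < (b + s ^ 2) ^ 2 := by linarith
    have hN1 : 0.2037 ≤ -(2 * a * s) := by nlinarith
    have hN2 : -(2 * a * s) ≤ 0.2292 := by nlinarith
    constructor
    · have : 1.5 ≤ -(2 * a * s) / (b + s ^ 2) ^ 2 := by
        rw [le_div_iff₀ hDpos]; nlinarith
      linarith
    · have : -(2 * a * s) / (b + s ^ 2) ^ 2 ≤ 2.24 := by
        rw [div_le_iff₀ hDpos]; nlinarith
      linarith
  · -- `s ∈ (−2/5, −7/20]`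
    have hs2' : 0.1225 ≤ s ^ 2 := by nlinarith
    have hs2'' : s ^ 2 ≤ 0.16 := by nlinarith
    have hD1 : 0.0798 ≤ (b + s ^ 2) ^ 2 := by nlinarith
    have hD2 : (b + s ^ 2) ^ 2 ≤ 0.1025 := by nlinarith
    have hDpos : 0 < (b + s ^ 2) ^ 2 := by linarith
    have hN1 : 0.1782 ≤ -(2 * a * s) := by nlinarith
    have hN2 : -(2 * a * s) ≤ 0.2038 := by nlinarith
    constructor
    · have : 1.5 ≤ -(2 * a * s) / (b + s ^ 2) ^ 2 := by
        rw [le_div_iff₀ hDpos]; nlinarith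
      linarith
    · have : -(2 * a * s) / (b + s ^ 2) ^ 2 ≤ 2.6 := by
        rw [div_le_iff₀ hDpos]; nlinarith
      linarith

end SelectionBoxRJRung

end Summit.NavierStokesRegularity.NavierStokesRegularity.Theorems
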